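import Literature.AlgebraicGeometry.ComplexMultiplication.CyclotomicFermatCMTypesBadOddCharacterCount
import HarnessLib

/-!
# Koblitz–Rohrlich's PROPOSITION at three-prime levels `N = pᵃqᵇrᶜ` ("Case 2. `m = 3`"), and THEOREMS 1 (i)–(ii), 2 in the relatively
# prime case UNCONDITIONALLY at such levels

Layer `Literature/AlgebraicGeometry/ComplexMultiplication`, namespace `…ComplexMultiplication.CyclotomicFermatCMType`; sequel of
`CyclotomicFermatCMTypesBadOddCharacterCount` (structural count `#S₀(N) ≤ Σ_{ℓ ∣ N} #{ψ mod N_ℓ odd : ψ(ℓ) = 1}`, `2·ord·# ≤ φ(N_ℓ)`) and of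
`CyclotomicFermatCMTypesOddLevelSimple` (Theorems 1–2 at any odd level under `12·#S₀(N) < φ(N)`); companion of
`CyclotomicFermatCMTypesTwoPrimeLevelSimple` (Case 1, `m = 2`).  THEOREMS ONLY (no definition, no named fact, no `sorry`).  Koblitz–Rohrlich,
§2, proof of the Proposition (p. 1191): "Note that `ordᵢ ≥ log_{pᵢ} Nᵢ ≥ m − i`.  Thus (1) `ordᵢ ≥ m + 1 − i`.  Also, (2) `ord_m = 1` only if
`p_m ≡ 1 (mod p₁⋯p_{m−1})`. … Case 2. `m = 3`.  If `pᵢ = 5` or `7`, then for `j < 5` Table 1 shows that `pᵢʲ − 1` is not divisible by two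
distinct primes `≥ 5`.  Hence `ordᵢ ≥ 5` and `(pᵢ − 1)ordᵢ ≥ 20`.  If `pᵢ ≥ 11`, then by (1) and (2) also `(pᵢ − 1)ordᵢ ≥ 20`.  Thus `s(N) ≤
3/20 < 1/6`."  Here `N = pᵃqᵇrᶜ` with distinct primes `p, q, r ≥ 5` and any `a, b, c ≥ 1`: each of the three summands `T_ℓ = #{ψ mod N_ℓ odd :
ψ(ℓ) = 1}` satisfies `40·T_ℓ ≤ φ(N)` (`= "≤ 1/20"` of `#S(N) = φ(N)/2`), so `12·(T_p + T_q + T_r) ≤ (9/10)φ(N) < φ(N)`.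

## The print

* N. Koblitz, D. Rohrlich, *Simple factors in the Jacobian of a Fermat curve*, Canad. J. Math. **30** (1978) 1183–1205
  [KoblitzRohrlich1978] (held `paper:koblitz1978-simple-factors-jacobian-fermat-curve`, pp. 1185–1191 read): Theorems 1–2 (pp. 1185–1186),
  §2 Proposition (p. 1190), its proof with (1), (2) and Case 2 (p. 1191), "TABLE 1. All primes `≥ 5` dividing `pᵐ − 1` for certain `p` and
  `m`" (p. 1190) — used here for `p ∈ {5, 7}`, `m ≤ 4`: `5 − 1 = 4`, `5² − 1 = 24`, `5³ − 1 = 4·31`, `5⁴ − 1 = 48·13`, `7 − 1 = 6`,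
  `7² − 1 = 48`, `7³ − 1 = 18·19`, `7⁴ − 1 = 96·25`.
* G. Shimura, *Abelian Varieties with Complex Multiplication and Modular Functions* (1998) [Shimura1998], §8.2 Prop. 26, §8.4 Example (1),
  §6.1 Corollary, §6.2 Theorem 3 (through the siblings).

## What is proved

* §1 **Table 1 for `j ≤ 4`**: `not_two_primes_dvd_pow_sub_one_of_le_four` — for `p ∈ {5, 7}` and `1 ≤ j ≤ 4`, `pʲ − 1` is not divisible by
  two distinct primes `≥ 5` (each value is `2ⁱ3ʲ·sᵏ` with a single prime `s`).
* §2 **`(pᵢ − 1)·ordᵢ ≥ 20`** `twenty_le_sub_one_mul_orderOf`: for a prime `p ≥ 5` prime to `M`, `M` divisible by two distinct primes `q, r ≥ 5`,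
  the order `d` of `p` modulo `M` has `20 ≤ (p − 1)d` (`M ∣ pᵈ − 1`; `p ∈ {5, 7}`: `d ≥ 5` by §1; `p ≥ 11`: `d ≥ 2`, or `d = 1` and `qr ∣ p − 1`,
  `p − 1 ≥ 25`); hence the per-prime bound `forty_mul_card_le`: **`40·#{ψ mod M odd : ψ(p) = 1} ≤ φ(pᵃ)·φ(M)`** (sibling's
  `2·ord·# ≤ φ(M)` and `p − 1 ≤ φ(pᵃ)`).
* §3 **THE PROPOSITION AT THREE-PRIME LEVELS**: `twelve_mul_sum_card_lt_totient_three_primes` (`12·Σ_{ℓ ∣ N} T_ℓ < φ(N)` for `N = pᵃqᵇrᶜ`: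
  `primeFactors N = {p, q, r}`, `ordCompl`s `qᵇrᶜ, pᵃrᶜ, pᵃqᵇ`, three applications of §2, `40·12·Σ ≤ 36·φ(N) < 40·φ(N)`),
  **`twelve_mul_card_bad_lt_totient_three_primes`** (`12·#{χ mod N odd : B_{1,χ} = 0} < φ(N)`, i.e. `#S₀(N) < #S(N)/6`), and the sibling's
  hypothesis `exists_goodFinset_three_primes`.
* §4 **THEOREMS 1 (i)–(ii) AND 2, RELATIVELY PRIME CASE, UNCONDITIONALLY AT `N = pᵃqᵇrᶜ`**: `forall_mem_fermatCMType_iff_iff_multiset_eq_threePrimes`,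
  `fermatCMType_eq_iff_multiset_eq_threePrimes`, `forall_mem_fermatCMType_one_iff_mul_mem_iff_threePrimes`, `isPrimitive_fermat_one_iff_threePrimes`,
  `isSimple_of_fermat_one_iff_threePrimes`, `isIsogenous_fermatCMType_iff_exists_multiset_eq_threePrimes`.

## Honest column / NOT here

* Only `m = 3` (with `m = 1, 2` in the siblings); K–R's Cases 3–5 (`m = 4`: `ordᵢ ≥ 9` for `pᵢ ∈ {5,7}` via Table 1 up to `j = 8`; `5 ≤ m ≤ 9`;
  `m ≥ 10`) are NOT typed — at levels with four or more distinct prime factors Theorems 1–2 remain conditional on `12·#S₀(N) < φ(N)`.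
* The parity refinement of Case 1 (sides killed by a power `≡ −1`) is not needed and not used here (as in the print: each summand `≤ 1/20`);
  exponents are carried along (`p − 1 ≤ φ(pᵃ)`) instead of K–R's reduction to `aᵢ = 1`.
* Relatively prime case only; boundary cases §§3–5, Theorems 3–4 not typed; statements about `H_{r,s,t}`, the CM types and all abelian varieties
  of those types (not the Fermat Jacobian itself), as in the siblings; the non-vacuity statement is not repeated (sibling's
  `exists_isSimple_of_fermat_one_of_card` applies with `exists_goodFinset_three_primes`).
* Private: `dvd_pow_orderOf_sub_one'`, `not_dvd_two_pow_mul_three_pow`, `eq_of_dvd_two_pow_mul_three_pow_mul_pow`, `card_level_congr'`,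
  `ordCompl_pow_mul_of_not_dvd`, `level_hyps₃`.

## References

* [KoblitzRohrlich1978] N. Koblitz, D. Rohrlich, Canad. J. Math. 30 (1978) 1183–1205: Theorems 1–2 (pp. 1185–1186), §2 Proposition (p. 1190),
  Case 2 (p. 1191), Table 1 (p. 1190).
* [Shimura1998] G. Shimura, *Abelian Varieties with Complex Multiplication and Modular Functions*, §6.1–6.2, §8.2 Prop. 26, §8.4 Example (1).

## Provenance

Cell `pub-hodgecm2` (COR-CM), literature seat `lit-deligne-3` gen 34 (claim KR78-THREEPRIMES; count-neutral, own lane).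
-/

noncomputable section

open NumberField

namespace Literature.AlgebraicGeometry.ComplexMultiplication

open Literature.NumberTheory.ComplexMultiplication
open Literature.NumberTheory.LFunctions

namespace CyclotomicFermatCMType

/-! ## §1 Orders of `5` and `7` modulo a number with two prime factors `≥ 5`: Table 1 for `j ≤ 4` -/

section Orders

variable {M : ℕ} [NeZero M]

/-- `M ∣ m^{ord(m)} − 1` for `m` prime to `M` (private copy of the sibling's). [folklore] -/
private theorem dvd_pow_orderOf_sub_one' {m : ℕ} (hm : m.Coprime M) :
    M ∣ m ^ orderOf (ZMod.unitOfCoprime m hm) - 1 := by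
  have hu : ((m : ZMod M)) ^ orderOf (ZMod.unitOfCoprime m hm) = 1 := by
    rw [← ZMod.coe_unitOfCoprime m hm, ← Units.val_pow_eq_pow_val, pow_orderOf_eq_one, Units.val_one]
  rcases Nat.eq_zero_or_pos m with h0 | hpos
  · subst h0
    have hM : M = 1 := (Nat.coprime_zero_left _).1 hm
    subst hM
    exact one_dvd _
  have h1 : 1 ≤ m ^ orderOf (ZMod.unitOfCoprime m hm) := Nat.one_le_pow _ _ hpos
  have h : ((m ^ orderOf (ZMod.unitOfCoprime m hm) - 1 : ℕ) : ZMod M) = 0 := by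
    rw [Nat.cast_sub h1, Nat.cast_pow, Nat.cast_one, hu, sub_self]
  exact (ZMod.natCast_eq_zero_iff _ _).1 h

omit [NeZero M] in
/-- A prime `≥ 5` does not divide `2ⁱ·3ʲ`. [folklore] -/
private theorem not_dvd_two_pow_mul_three_pow {q : ℕ} (hq : q.Prime) (h5 : 5 ≤ q) (i j : ℕ) : ¬q ∣ 2 ^ i * 3 ^ j := by
  intro h
  rcases (Nat.Prime.dvd_mul hq).1 h with h2 | h3
  · have := (Nat.prime_dvd_prime_iff_eq hq Nat.prime_two).1 (hq.dvd_of_dvd_pow h2)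
    omega
  · have := (Nat.prime_dvd_prime_iff_eq hq Nat.prime_three).1 (hq.dvd_of_dvd_pow h3)
    omega

omit [NeZero M] in
/-- A prime `q ≥ 5` dividing `2ⁱ·3ʲ·sᵏ` (`s` prime) is `s`. [folklore] -/
private theorem eq_of_dvd_two_pow_mul_three_pow_mul_pow {q s : ℕ} (hq : q.Prime) (h5 : 5 ≤ q) (hs : s.Prime) (i j k : ℕ)
    (h : q ∣ 2 ^ i * 3 ^ j * s ^ k) : q = s := by
  rcases (Nat.Prime.dvd_mul hq).1 h with h23 | hsk
  · exact absurd h23 (not_dvd_two_pow_mul_three_pow hq h5 i j)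
  · exact (Nat.prime_dvd_prime_iff_eq hq hs).1 (hq.dvd_of_dvd_pow hsk)

omit [NeZero M] in
/-- **TABLE 1 for `p ∈ {5, 7}`, `j ≤ 4`**: `pʲ − 1` is not divisible by two DISTINCT primes `≥ 5` — `5¹−1 = 4`, `5²−1 = 24`, `5³−1 = 4·31`,
`5⁴−1 = 48·13`, `7¹−1 = 6`, `7²−1 = 48`, `7³−1 = 18·19`, `7⁴−1 = 96·25` ("if `pᵢ = 5` or `7`, then for `j < 5` Table 1 shows that `pᵢʲ − 1` is not
divisible by two distinct primes"). [cite: KoblitzRohrlich1978, §2 Table 1 (p. 1190) and Case 2 (p. 1191)] -/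
theorem not_two_primes_dvd_pow_sub_one_of_le_four {p q r j : ℕ} (hp : p = 5 ∨ p = 7) (hq : q.Prime) (hr : r.Prime)
    (hq5 : 5 ≤ q) (hr5 : 5 ≤ r) (hqr : q ≠ r) (hj0 : 0 < j) (hj : j ≤ 4) (hqd : q ∣ p ^ j - 1) (hrd : r ∣ p ^ j - 1) :
    False := by
  have key : ∀ {i₂ i₃ s k : ℕ}, s.Prime → p ^ j - 1 = 2 ^ i₂ * 3 ^ i₃ * s ^ k → False := by
    intro i₂ i₃ s k hs he
    rw [he] at hqd hrd
    exact hqr ((eq_of_dvd_two_pow_mul_three_pow_mul_pow hq hq5 hs _ _ _ hqd).trans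
      (eq_of_dvd_two_pow_mul_three_pow_mul_pow hr hr5 hs _ _ _ hrd).symm)
  have hj' : j = 1 ∨ j = 2 ∨ j = 3 ∨ j = 4 := by omega
  rcases hp with rfl | rfl <;> rcases hj' with rfl | rfl | rfl | rfl
  · exact key (s := 5) (k := 0) (i₂ := 2) (i₃ := 0) (by norm_num) (by norm_num)
  · exact key (s := 5) (k := 0) (i₂ := 3) (i₃ := 1) (by norm_num) (by norm_num)
  · exact key (s := 31) (k := 1) (i₂ := 2) (i₃ := 0) (by norm_num) (by norm_num)
  · exact key (s := 13) (k := 1) (i₂ := 4) (i₃ := 1) (by norm_num) (by norm_num)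
  · exact key (s := 7) (k := 0) (i₂ := 1) (i₃ := 1) (by norm_num) (by norm_num)
  · exact key (s := 7) (k := 0) (i₂ := 4) (i₃ := 1) (by norm_num) (by norm_num)
  · exact key (s := 19) (k := 1) (i₂ := 1) (i₃ := 2) (by norm_num) (by norm_num)
  · exact key (s := 5) (k := 2) (i₂ := 5) (i₃ := 1) (by norm_num) (by norm_num)

end Orders

/-! ## §2 Koblitz–Rohrlich's `(pᵢ − 1)·ordᵢ ≥ 20` when `Nᵢ` has two prime factors `≥ 5`, and the per-prime bound `40·#Tᵢ ≤ φ(N)` -/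

section PerPrime

variable {M : ℕ} [NeZero M]

/-- **`(pᵢ − 1)·ordᵢ ≥ 20`** (K–R Case 2: "If `pᵢ = 5` or `7`, then … `ordᵢ ≥ 5` and `(pᵢ − 1)ordᵢ ≥ 20`.  If `pᵢ ≥ 11`, then by (1) and (2) also
`(pᵢ − 1)ordᵢ ≥ 20`"): for a prime `p ≥ 5` prime to `M`, where `M` is divisible by two distinct primes `q, r ≥ 5`, the order `d` of `p` modulo
`M` satisfies `20 ≤ (p − 1)·d` (`M ∣ pᵈ − 1`; `p ∈ {5,7}`: Table 1 forces `d ≥ 5`; `p ≥ 11`: `d ≥ 2`, or `d = 1` and `qr ∣ p − 1`).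
[cite: KoblitzRohrlich1978, §2 Proposition, Case 2 (p. 1191)] -/
theorem twenty_le_sub_one_mul_orderOf {p q r : ℕ} (hp : p.Prime) (hp5 : 5 ≤ p) (hpM : p.Coprime M) (hq : q.Prime) (hr : r.Prime)
    (hq5 : 5 ≤ q) (hr5 : 5 ≤ r) (hqr : q ≠ r) (hqM : q ∣ M) (hrM : r ∣ M) :
    20 ≤ (p - 1) * orderOf (ZMod.unitOfCoprime p hpM) := by
  obtain ⟨d, hd⟩ : ∃ d, orderOf (ZMod.unitOfCoprime p hpM) = d := ⟨_, rfl⟩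
  have hMd : M ∣ p ^ d - 1 := by
    have h := dvd_pow_orderOf_sub_one' hpM
    rwa [hd] at h
  have hd0 : 0 < d := by
    rw [← hd]
    exact orderOf_pos _
  rw [hd]
  by_cases hp11 : 11 ≤ p
  · -- `p ≥ 11`: `d ≥ 2`, or `d = 1` and `q·r ∣ p − 1`
    by_cases hd2 : 2 ≤ d
    · calc 20 = 10 * 2 := by norm_num
        _ ≤ (p - 1) * d := Nat.mul_le_mul (by omega) hd2
    · have hd1 : d = 1 := by omega
      rw [hd1, pow_one] at hMd
      have hqr' : q * r ∣ p - 1 :=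
        (Nat.Coprime.mul_dvd_of_dvd_of_dvd ((Nat.coprime_primes hq hr).2 hqr) (dvd_trans hqM hMd) (dvd_trans hrM hMd))
      have h25 : 25 ≤ q * r := Nat.mul_le_mul hq5 hr5
      have hle : q * r ≤ p - 1 := Nat.le_of_dvd (by omega) hqr'
      rw [hd1, mul_one]
      omega
  · -- `p ∈ {5, 7}`: `d ≥ 5` by Table 1
    have hp57 : p = 5 ∨ p = 7 := by
      interval_cases p
      · exact Or.inl rfl
      · exact absurd hp (by decide)
      · exact Or.inr rfl
      · exact absurd hp (by decide)
      · exact absurd hp (by decide)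
      · exact absurd hp (by decide)
    have hd5 : 5 ≤ d := by
      by_contra hlt
      exact not_two_primes_dvd_pow_sub_one_of_le_four hp57 hq hr hq5 hr5 hqr hd0 (by omega)
        (dvd_trans hqM hMd) (dvd_trans hrM hMd)
    calc 20 = 4 * 5 := by norm_num
      _ ≤ (p - 1) * d := Nat.mul_le_mul (by omega) hd5

/-- **The per-prime bound at a level with three prime factors**: with `T = #{ψ mod M odd : ψ(p) = 1}`, `M` coprime to `p` and divisible by two
distinct primes `q, r ≥ 5`, and any `a ≥ 1`: `40·T ≤ φ(pᵃ)·φ(M)` (from `2·ord·T ≤ φ(M)`, `(p − 1)·ord ≥ 20`, `p − 1 ≤ φ(pᵃ)` — K–R's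
`s`-summand `≤ 1/20`). [cite: KoblitzRohrlich1978, §2 Proposition, Case 2 (p. 1191)] -/
theorem forty_mul_card_le {p q r a : ℕ} (hp : p.Prime) (hp5 : 5 ≤ p) (hpM : p.Coprime M) (hq : q.Prime) (hr : r.Prime)
    (hq5 : 5 ≤ q) (hr5 : 5 ≤ r) (hqr : q ≠ r) (hqM : q ∣ M) (hrM : r ∣ M) (ha : a ≠ 0) :
    40 * Nat.card {ψ : DirichletCharacter ℂ M // ψ.Odd ∧ ψ (p : ZMod M) = 1} ≤ (p ^ a).totient * M.totient := by
  have hT : Nat.card {ψ : DirichletCharacter ℂ M // ψ.Odd ∧ ψ (p : ZMod M) = 1} =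
      Nat.card {ψ : DirichletCharacter ℂ M // ψ.Odd ∧ ψ (ZMod.unitOfCoprime p hpM) = 1} := by
    refine Nat.card_congr (Equiv.subtypeEquivRight fun ψ => ?_)
    rw [ZMod.coe_unitOfCoprime]
  rw [hT]
  set T := Nat.card {ψ : DirichletCharacter ℂ M // ψ.Odd ∧ ψ (ZMod.unitOfCoprime p hpM) = 1}
  set d := orderOf (ZMod.unitOfCoprime p hpM)
  have h2 : 2 * d * T ≤ M.totient := two_mul_orderOf_mul_card_odd_apply_eq_one_le _
  have h20 : 20 ≤ (p - 1) * d := twenty_le_sub_one_mul_orderOf hp hp5 hpM hq hr hq5 hr5 hqr hqM hrM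
  have hΦ : p - 1 ≤ (p ^ a).totient := by
    rw [Nat.totient_prime_pow hp (Nat.pos_of_ne_zero ha)]
    calc p - 1 = 1 * (p - 1) := (one_mul _).symm
      _ ≤ p ^ (a - 1) * (p - 1) := Nat.mul_le_mul_right _ (Nat.one_le_pow _ _ hp.pos)
  calc 40 * T = 2 * 20 * T := by ring
    _ ≤ 2 * ((p - 1) * d) * T := Nat.mul_le_mul_right _ (Nat.mul_le_mul_left 2 h20)
    _ = (p - 1) * (2 * d * T) := by ring
    _ ≤ (p - 1) * M.totient := Nat.mul_le_mul_left _ h2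
    _ ≤ (p ^ a).totient * M.totient := Nat.mul_le_mul_right _ hΦ

end PerPrime

/-! ## §3 The Proposition at three-prime levels `N = pᵃqᵇrᶜ`: `12·#S₀(N) < φ(N)` ("Case 2. `m = 3` … `s(N) ≤ 3/20 < 1/6`") -/

section ThreePrimes

/-- Transport of the side count along an equality of moduli (private copy). [folklore] -/
private theorem card_level_congr' (r : ℕ) {M M' : ℕ} (h : M = M') :
    Nat.card {ψ : DirichletCharacter ℂ M // ψ.Odd ∧ ψ (r : ZMod M) = 1} =
      Nat.card {ψ : DirichletCharacter ℂ M' // ψ.Odd ∧ ψ (r : ZMod M') = 1} := by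
  subst h
  rfl

/-- `ordCompl[p] (pᵃ·M) = M` for `p ∤ M`. [folklore] -/
private theorem ordCompl_pow_mul_of_not_dvd {p a M : ℕ} (hp : p.Prime) (hM : ¬p ∣ M) : ordCompl[p] (p ^ a * M) = M := by
  rw [Nat.ordCompl_self_pow_mul M a hp, (Nat.ordCompl_eq_self_iff_zero_or_not_dvd _ hp).2 (Or.inr hM)]

/-- **THE PROPOSITION AT THREE-PRIME LEVELS** (K–R "Case 2. `m = 3`": each `s`-summand `≤ 1/20`, `s(N) ≤ 3/20 < 1/6`): for `N = pᵃqᵇrᶜ` with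
distinct primes `p, q, r ≥ 5` and `a, b, c ≥ 1`, `12·Σ_{ℓ ∣ N} #{ψ mod N_ℓ odd : ψ(ℓ) = 1} < φ(N)` (indeed `≤ (9/10)φ(N)`).
[cite: KoblitzRohrlich1978, §2 Proposition (p. 1190) and Case 2 (p. 1191)] -/
theorem twelve_mul_sum_card_lt_totient_three_primes {p q r a b c N : ℕ} (hp : p.Prime) (hq : q.Prime) (hr : r.Prime)
    (hp5 : 5 ≤ p) (hq5 : 5 ≤ q) (hr5 : 5 ≤ r) (hpq : p ≠ q) (hpr : p ≠ r) (hqr : q ≠ r) (ha : a ≠ 0) (hb : b ≠ 0) (hc : c ≠ 0)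
    (hN : N = p ^ a * q ^ b * r ^ c) :
    12 * ∑ ℓ ∈ N.primeFactors,
        Nat.card {ψ : DirichletCharacter ℂ (ordCompl[ℓ] N) // ψ.Odd ∧ ψ (ℓ : ZMod (ordCompl[ℓ] N)) = 1} < N.totient := by
  subst hN
  -- coprimalities
  have cpq : p.Coprime q := (Nat.coprime_primes hp hq).2 hpq
  have cpr : p.Coprime r := (Nat.coprime_primes hp hr).2 hpr
  have cqr : q.Coprime r := (Nat.coprime_primes hq hr).2 hqr
  haveI : NeZero (q ^ b * r ^ c) := ⟨Nat.pos_iff_ne_zero.1 (Nat.mul_pos (pow_pos hq.pos b) (pow_pos hr.pos c))⟩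
  haveI : NeZero (p ^ a * r ^ c) := ⟨Nat.pos_iff_ne_zero.1 (Nat.mul_pos (pow_pos hp.pos a) (pow_pos hr.pos c))⟩
  haveI : NeZero (p ^ a * q ^ b) := ⟨Nat.pos_iff_ne_zero.1 (Nat.mul_pos (pow_pos hp.pos a) (pow_pos hq.pos b))⟩
  -- prime factors and complementary parts
  have hpf : (p ^ a * q ^ b * r ^ c).primeFactors = {p, q, r} := by
    have hA : (p ^ a * q ^ b).Coprime (r ^ c) :=
      Nat.Coprime.mul_left ((cpr.pow_right c).pow_left a) ((cqr.pow_right c).pow_left b)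
    rw [Nat.Coprime.primeFactors_mul hA, Nat.Coprime.primeFactors_mul ((cpq.pow_right b).pow_left a),
      Nat.primeFactors_prime_pow ha hp, Nat.primeFactors_prime_pow hb hq, Nat.primeFactors_prime_pow hc hr]
    ext x
    simp
  have hnp : ¬p ∣ q ^ b * r ^ c := fun h => by
    rcases (Nat.Prime.dvd_mul hp).1 h with h1 | h1
    · exact hpq ((Nat.prime_dvd_prime_iff_eq hp hq).1 (hp.dvd_of_dvd_pow h1))
    · exact hpr ((Nat.prime_dvd_prime_iff_eq hp hr).1 (hp.dvd_of_dvd_pow h1))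
  have hnq : ¬q ∣ p ^ a * r ^ c := fun h => by
    rcases (Nat.Prime.dvd_mul hq).1 h with h1 | h1
    · exact hpq.symm ((Nat.prime_dvd_prime_iff_eq hq hp).1 (hq.dvd_of_dvd_pow h1))
    · exact hqr ((Nat.prime_dvd_prime_iff_eq hq hr).1 (hq.dvd_of_dvd_pow h1))
  have hnr : ¬r ∣ p ^ a * q ^ b := fun h => by
    rcases (Nat.Prime.dvd_mul hr).1 h with h1 | h1
    · exact hpr.symm ((Nat.prime_dvd_prime_iff_eq hr hp).1 (hr.dvd_of_dvd_pow h1))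
    · exact hqr.symm ((Nat.prime_dvd_prime_iff_eq hr hq).1 (hr.dvd_of_dvd_pow h1))
  have h1 : ordCompl[p] (p ^ a * q ^ b * r ^ c) = q ^ b * r ^ c := by
    rw [mul_assoc]
    exact ordCompl_pow_mul_of_not_dvd hp hnp
  have h2 : ordCompl[q] (p ^ a * q ^ b * r ^ c) = p ^ a * r ^ c := by
    rw [show p ^ a * q ^ b * r ^ c = q ^ b * (p ^ a * r ^ c) by ring]
    exact ordCompl_pow_mul_of_not_dvd hq hnq
  have h3 : ordCompl[r] (p ^ a * q ^ b * r ^ c) = p ^ a * q ^ b := by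
    rw [show p ^ a * q ^ b * r ^ c = r ^ c * (p ^ a * q ^ b) by ring]
    exact ordCompl_pow_mul_of_not_dvd hr hnr
  -- the three per-prime bounds `40·T ≤ φ(N)`
  have hTp := forty_mul_card_le (M := q ^ b * r ^ c) hp hp5 ((hp.coprime_iff_not_dvd).2 hnp) hq hr hq5 hr5 hqr
    (dvd_mul_of_dvd_left (dvd_pow_self q hb) _) (dvd_mul_of_dvd_right (dvd_pow_self r hc) _) ha
  have hTq := forty_mul_card_le (M := p ^ a * r ^ c) hq hq5 ((hq.coprime_iff_not_dvd).2 hnq) hp hr hp5 hr5 hpr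
    (dvd_mul_of_dvd_left (dvd_pow_self p ha) _) (dvd_mul_of_dvd_right (dvd_pow_self r hc) _) hb
  have hTr := forty_mul_card_le (M := p ^ a * q ^ b) hr hr5 ((hr.coprime_iff_not_dvd).2 hnr) hp hq hp5 hq5 hpq
    (dvd_mul_of_dvd_left (dvd_pow_self p ha) _) (dvd_mul_of_dvd_right (dvd_pow_self q hb) _) hc
  -- the totient of `N` in the three splittings
  have hφ1 : (p ^ a * q ^ b * r ^ c).totient = (p ^ a).totient * (q ^ b * r ^ c).totient := by
    rw [mul_assoc, Nat.totient_mul (Nat.Coprime.mul_right ((cpq.pow_right b).pow_left a) ((cpr.pow_right c).pow_left a))]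
  have hφ2 : (p ^ a * q ^ b * r ^ c).totient = (q ^ b).totient * (p ^ a * r ^ c).totient := by
    rw [show p ^ a * q ^ b * r ^ c = q ^ b * (p ^ a * r ^ c) by ring,
      Nat.totient_mul (Nat.Coprime.mul_right ((cpq.symm.pow_right a).pow_left b) ((cqr.pow_right c).pow_left b))]
  have hφ3 : (p ^ a * q ^ b * r ^ c).totient = (r ^ c).totient * (p ^ a * q ^ b).totient := by
    rw [show p ^ a * q ^ b * r ^ c = r ^ c * (p ^ a * q ^ b) by ring,
      Nat.totient_mul (Nat.Coprime.mul_right ((cpr.symm.pow_right a).pow_left c) ((cqr.symm.pow_right b).pow_left c))]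
  have hφpos : 0 < (p ^ a * q ^ b * r ^ c).totient :=
    Nat.totient_pos.2 (Nat.mul_pos (Nat.mul_pos (pow_pos hp.pos a) (pow_pos hq.pos b)) (pow_pos hr.pos c))
  have hmem1 : p ∉ ({q, r} : Finset ℕ) := by simp [hpq, hpr]
  have hmem2 : q ∉ ({r} : Finset ℕ) := by simp [hqr]
  rw [hpf, Finset.sum_insert hmem1, Finset.sum_insert hmem2, Finset.sum_singleton, card_level_congr' p h1,
    card_level_congr' q h2, card_level_congr' r h3]
  rw [← hφ1] at hTp
  rw [← hφ2] at hTq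
  rw [← hφ3] at hTr
  omega

/-- **`12·#S₀(N) < φ(N)`, i.e. `#S₀(N) < #S(N)/6`, at three-prime levels** `N = pᵃqᵇrᶜ` (distinct primes `≥ 5`).
[cite: KoblitzRohrlich1978, §2 Proposition (p. 1190) and Case 2 (p. 1191)] -/
theorem twelve_mul_card_bad_lt_totient_three_primes {p q r a b c N : ℕ} [NeZero N] (hp : p.Prime) (hq : q.Prime) (hr : r.Prime)
    (hp5 : 5 ≤ p) (hq5 : 5 ≤ q) (hr5 : 5 ≤ r) (hpq : p ≠ q) (hpr : p ≠ r) (hqr : q ≠ r) (ha : a ≠ 0) (hb : b ≠ 0) (hc : c ≠ 0)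
    (hN : N = p ^ a * q ^ b * r ^ c) :
    12 * Nat.card {χ : DirichletCharacter ℂ N // χ.Odd ∧ bernoulliOneChar χ = 0} < N.totient :=
  lt_of_le_of_lt (Nat.mul_le_mul_left _ card_odd_bernoulliOneChar_eq_zero_le)
    (twelve_mul_sum_card_lt_totient_three_primes hp hq hr hp5 hq5 hr5 hpq hpr hqr ha hb hc hN)

/-- The sibling's hypothesis at three-prime levels: a finset `S₀ ⊇ {χ mod N odd : B_{1,χ} = 0}` with `12·#S₀ < φ(N)`.
[cite: KoblitzRohrlich1978, §2 Proposition (p. 1190)] -/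
theorem exists_goodFinset_three_primes {p q r a b c N : ℕ} [NeZero N] (hp : p.Prime) (hq : q.Prime) (hr : r.Prime)
    (hp5 : 5 ≤ p) (hq5 : 5 ≤ q) (hr5 : 5 ≤ r) (hpq : p ≠ q) (hpr : p ≠ r) (hqr : q ≠ r) (ha : a ≠ 0) (hb : b ≠ 0) (hc : c ≠ 0)
    (hN : N = p ^ a * q ^ b * r ^ c) :
    ∃ S₀ : Finset (DirichletCharacter ℂ N),
      (∀ ψ : DirichletCharacter ℂ N, ψ.Odd → bernoulliOneChar ψ = 0 → ψ ∈ S₀) ∧ 12 * S₀.card < N.totient :=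
  exists_goodFinset_of_sum_lt (twelve_mul_sum_card_lt_totient_three_primes hp hq hr hp5 hq5 hr5 hpq hpr hqr ha hb hc hN)

end ThreePrimes

/-! ## §4 Theorems 1 (i)–(ii) and 2, relatively prime case, UNCONDITIONALLY at three-prime levels `N = pᵃqᵇrᶜ` -/

section ThreePrimeLevel

open CategoryTheory
open Literature.AlgebraicGeometry.Motives (AbelianVariety)
open Literature.AlgebraicGeometry.HodgeTheory
open Literature.AlgebraicGeometry.Pohlmann1968 Literature.AlgebraicGeometry.Pohlmann1968.Cyclotomic
open CyclotomicCMTypeResidueSets (IsCMResidueSet)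

variable {p q r a b c N : ℕ} [NeZero N]

/-- At a three-prime level: `1 < N` and `N` odd. [folklore] -/
private theorem level_hyps₃ (hp : p.Prime) (hq : q.Prime) (hr : r.Prime) (hp5 : 5 ≤ p) (hq5 : 5 ≤ q) (hr5 : 5 ≤ r) (ha : a ≠ 0)
    (hN : N = p ^ a * q ^ b * r ^ c) : 1 < N ∧ Odd N := by
  subst hN
  have hp2 : p ≠ 2 := by omega
  have hq2 : q ≠ 2 := by omega
  have hr2 : r ≠ 2 := by omega
  refine ⟨?_, ((hp.odd_of_ne_two hp2).pow.mul (hq.odd_of_ne_two hq2).pow).mul (hr.odd_of_ne_two hr2).pow⟩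
  calc 1 < p ^ a := Nat.one_lt_pow ha (by omega)
    _ ≤ p ^ a * q ^ b := Nat.le_mul_of_pos_right _ (pow_pos hq.pos b)
    _ ≤ p ^ a * q ^ b * r ^ c := Nat.le_mul_of_pos_right _ (pow_pos hr.pos c)

/-- **THEOREM 1 (i) at three-prime levels, unconditionally**: `H_{r',s',t'} = h⁻¹H_{r,s,t}` iff `{r',s',t'} = {hr,hs,ht}` for unit triples
modulo `N = pᵃqᵇrᶜ` (distinct primes `≥ 5`). [cite: KoblitzRohrlich1978, Theorem 1 (i) (p. 1185), §2 Lemma and Proposition (pp. 1188–1191)] -/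
theorem forall_mem_fermatCMType_iff_iff_multiset_eq_threePrimes (hp : p.Prime) (hq : q.Prime) (hr : r.Prime) (hp5 : 5 ≤ p)
    (hq5 : 5 ≤ q) (hr5 : 5 ≤ r) (hpq : p ≠ q) (hpr : p ≠ r) (hqr : q ≠ r) (ha : a ≠ 0) (hb : b ≠ 0) (hc : c ≠ 0)
    (hN : N = p ^ a * q ^ b * r ^ c) {r₁ s₁ t₁ r₂ s₂ t₂ h : ZMod N}
    (hr₁ : IsUnit r₁) (hs₁ : IsUnit s₁) (ht₁ : IsUnit t₁) (h₁ : r₁ + s₁ + t₁ = 0)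
    (hr₂ : IsUnit r₂) (hs₂ : IsUnit s₂) (ht₂ : IsUnit t₂) (h₂ : r₂ + s₂ + t₂ = 0) (hh : IsUnit h) :
    (∀ x, x ∈ fermatCMType N r₂ s₂ t₂ ↔ h * x ∈ fermatCMType N r₁ s₁ t₁) ↔
      ({r₂, s₂, t₂} : Multiset (ZMod N)) = {h * r₁, h * s₁, h * t₁} := by
  obtain ⟨S₀, hS₀, hcard⟩ := exists_goodFinset_three_primes hp hq hr hp5 hq5 hr5 hpq hpr hqr ha hb hc hN
  obtain ⟨hN1, hN2⟩ := level_hyps₃ hp hq hr hp5 hq5 hr5 ha hN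
  exact forall_mem_fermatCMType_iff_iff_multiset_eq_of_card hN1 hN2 S₀ hS₀ hcard hr₁ hs₁ ht₁ h₁ hr₂ hs₂ ht₂ h₂ hh

/-- **(∗) at three-prime levels**: `H_{r₂,s₂,t₂} = H_{r₁,s₁,t₁}` iff `{r₂,s₂,t₂} = {r₁,s₁,t₁}`. [cite: KoblitzRohrlich1978, §2 (∗) (p. 1187) and Proposition (p. 1190)] -/
theorem fermatCMType_eq_iff_multiset_eq_threePrimes (hp : p.Prime) (hq : q.Prime) (hr : r.Prime) (hp5 : 5 ≤ p) (hq5 : 5 ≤ q)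
    (hr5 : 5 ≤ r) (hpq : p ≠ q) (hpr : p ≠ r) (hqr : q ≠ r) (ha : a ≠ 0) (hb : b ≠ 0) (hc : c ≠ 0)
    (hN : N = p ^ a * q ^ b * r ^ c) {r₁ s₁ t₁ r₂ s₂ t₂ : ZMod N}
    (hr₁ : IsUnit r₁) (hs₁ : IsUnit s₁) (ht₁ : IsUnit t₁) (h₁ : r₁ + s₁ + t₁ = 0)
    (hr₂ : IsUnit r₂) (hs₂ : IsUnit s₂) (ht₂ : IsUnit t₂) (h₂ : r₂ + s₂ + t₂ = 0) :
    fermatCMType N r₂ s₂ t₂ = fermatCMType N r₁ s₁ t₁ ↔ ({r₂, s₂, t₂} : Multiset (ZMod N)) = {r₁, s₁, t₁} := by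
  obtain ⟨S₀, hS₀, hcard⟩ := exists_goodFinset_three_primes hp hq hr hp5 hq5 hr5 hpq hpr hqr ha hb hc hN
  obtain ⟨hN1, hN2⟩ := level_hyps₃ hp hq hr hp5 hq5 hr5 ha hN
  exact fermatCMType_eq_iff_multiset_eq_of_card hN1 hN2 S₀ hS₀ hcard hr₁ hs₁ ht₁ h₁ hr₂ hs₂ ht₂ h₂

/-- **THEOREM 2's stabiliser at three-prime levels.** [cite: KoblitzRohrlich1978, Theorem 2 (pp. 1185–1186) and Proposition (p. 1190)] -/
theorem forall_mem_fermatCMType_one_iff_mul_mem_iff_threePrimes (hp : p.Prime) (hq : q.Prime) (hr : r.Prime) (hp5 : 5 ≤ p)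
    (hq5 : 5 ≤ q) (hr5 : 5 ≤ r) (hpq : p ≠ q) (hpr : p ≠ r) (hqr : q ≠ r) (ha : a ≠ 0) (hb : b ≠ 0) (hc : c ≠ 0)
    (hN : N = p ^ a * q ^ b * r ^ c) {a₀ w : ZMod N} (ha₀ : IsUnit a₀) (ha₁ : IsUnit (1 + a₀)) (hw : IsUnit w) :
    (∀ x, x ∈ fermatCMType N 1 a₀ (-1 - a₀) ↔ w * x ∈ fermatCMType N 1 a₀ (-1 - a₀)) ↔
      w = 1 ∨ (1 + a₀ + a₀ ^ 2 = 0 ∧ (w = a₀ ∨ w = a₀ ^ 2)) := by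
  obtain ⟨S₀, hS₀, hcard⟩ := exists_goodFinset_three_primes hp hq hr hp5 hq5 hr5 hpq hpr hqr ha hb hc hN
  obtain ⟨hN1, hN2⟩ := level_hyps₃ hp hq hr hp5 hq5 hr5 ha hN
  exact forall_mem_fermatCMType_one_iff_mul_mem_iff_of_card hN1 hN2 S₀ hS₀ hcard ha₀ ha₁ hw

variable {L : Type} [Field L] [NumberField L] [IsCyclotomicExtension {N} ℚ L]
  {A A' : AbelianVariety ℂ} {ι : 𝓞 L →+* End A} {θ : L →+* Module.End ℂ (complexBetti A.X 1)}
  {ι' : 𝓞 L →+* End A'} {θ' : L →+* Module.End ℂ (complexBetti A'.X 1)}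

/-- **THEOREM 2 on CM types at three-prime levels**: `Φ_{(1,a₀,−1−a₀)}` is primitive iff NOT (`1 + a₀ + a₀² = 0` and `a₀ ≠ 1`).
[cite: KoblitzRohrlich1978, Theorem 2 (pp. 1185–1186) and Proposition (p. 1190)] [cite: Shimura1998, §8.2 Prop. 26] -/
theorem isPrimitive_fermat_one_iff_threePrimes (hp : p.Prime) (hq : q.Prime) (hr : r.Prime) (hp5 : 5 ≤ p) (hq5 : 5 ≤ q)
    (hr5 : 5 ≤ r) (hpq : p ≠ q) (hpr : p ≠ r) (hqr : q ≠ r) (ha : a ≠ 0) (hb : b ≠ 0) (hc : c ≠ 0)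
    (hN : N = p ^ a * q ^ b * r ^ c) {a₀ : ZMod N} (ha₀ : IsUnit a₀) (ha₁ : IsUnit (1 + a₀))
    {hS : ∀ x : ZMod N, x.val.Coprime N → (x ∈ fermatCMType N 1 a₀ (-1 - a₀) ↔ -x ∉ fermatCMType N 1 a₀ (-1 - a₀))}
    (φ₀ : L →+* ℂ) :
    IsPrimitive (ℂ ≃+* ℂ) (cmTypeOfResidues (L := L) (fermatCMType N 1 a₀ (-1 - a₀)) hS).1 φ₀ ↔
      ¬(1 + a₀ + a₀ ^ 2 = 0 ∧ a₀ ≠ 1) := by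
  obtain ⟨S₀, hS₀, hcard⟩ := exists_goodFinset_three_primes hp hq hr hp5 hq5 hr5 hpq hpr hqr ha hb hc hN
  obtain ⟨hN1, hN2⟩ := level_hyps₃ hp hq hr hp5 hq5 hr5 ha hN
  exact isPrimitive_fermat_one_iff_of_card hN1 hN2 S₀ hS₀ hcard ha₀ ha₁ φ₀

/-- **THEOREM 2 on abelian varieties at three-prime levels**: simple iff NOT (`1 + a₀ + a₀² = 0` and `a₀ ≠ 1`).
[cite: KoblitzRohrlich1978, Theorem 2 (pp. 1185–1186) and Proposition (p. 1190)] [cite: Shimura1998, §8.2 Prop. 26] -/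
theorem isSimple_of_fermat_one_iff_threePrimes (hp : p.Prime) (hq : q.Prime) (hr : r.Prime) (hp5 : 5 ≤ p) (hq5 : 5 ≤ q)
    (hr5 : 5 ≤ r) (hpq : p ≠ q) (hpr : p ≠ r) (hqr : q ≠ r) (ha : a ≠ 0) (hb : b ≠ 0) (hc : c ≠ 0)
    (hN : N = p ^ a * q ^ b * r ^ c) {a₀ : ZMod N} (ha₀ : IsUnit a₀) (ha₁ : IsUnit (1 + a₀))
    {hS : ∀ x : ZMod N, x.val.Coprime N → (x ∈ fermatCMType N 1 a₀ (-1 - a₀) ↔ -x ∉ fermatCMType N 1 a₀ (-1 - a₀))}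
    (hA : IsCMTypeRealisation (cmTypeOfResidues (L := L) (fermatCMType N 1 a₀ (-1 - a₀)) hS) A ι θ) :
    A.IsSimple ↔ ¬(1 + a₀ + a₀ ^ 2 = 0 ∧ a₀ ≠ 1) := by
  obtain ⟨S₀, hS₀, hcard⟩ := exists_goodFinset_three_primes hp hq hr hp5 hq5 hr5 hpq hpr hqr ha hb hc hN
  obtain ⟨hN1, hN2⟩ := level_hyps₃ hp hq hr hp5 hq5 hr5 ha hN
  exact isSimple_of_fermat_one_iff_of_card hN1 hN2 S₀ hS₀ hcard ha₀ ha₁ hA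

/-- **THEOREM 1 (ii) at three-prime levels**: isogeny iff `{r₂,s₂,t₂} = u·{r₁,s₁,t₁}` for a unit `u`.
[cite: KoblitzRohrlich1978, Theorem 1 (ii) (p. 1185) and Proposition (p. 1190)] [cite: Shimura1998, §8.4 Example (1) and §6.1 Corollary] -/
theorem isIsogenous_fermatCMType_iff_exists_multiset_eq_threePrimes [IsCMField L] (hp : p.Prime) (hq : q.Prime) (hr : r.Prime)
    (hp5 : 5 ≤ p) (hq5 : 5 ≤ q) (hr5 : 5 ≤ r) (hpq : p ≠ q) (hpr : p ≠ r) (hqr : q ≠ r) (ha : a ≠ 0) (hb : b ≠ 0) (hc : c ≠ 0)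
    (hN : N = p ^ a * q ^ b * r ^ c) {r₁ s₁ t₁ r₂ s₂ t₂ : ZMod N}
    (hr₁ : IsUnit r₁) (hs₁ : IsUnit s₁) (ht₁ : IsUnit t₁) (h₁ : r₁ + s₁ + t₁ = 0)
    (hr₂ : IsUnit r₂) (hs₂ : IsUnit s₂) (ht₂ : IsUnit t₂) (h₂ : r₂ + s₂ + t₂ = 0)
    (hS : IsCMResidueSet N (fermatCMType N r₁ s₁ t₁)) (hS' : IsCMResidueSet N (fermatCMType N r₂ s₂ t₂))
    (hA : IsCMTypeRealisation (cmTypeOfResidues (L := L) (fermatCMType N r₁ s₁ t₁) hS.cm) A ι θ)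
    (hA' : IsCMTypeRealisation (cmTypeOfResidues (L := L) (fermatCMType N r₂ s₂ t₂) hS'.cm) A' ι' θ') :
    AbelianVariety.IsIsogenous A A' ↔
      ∃ u : ZMod N, IsUnit u ∧ ({r₂, s₂, t₂} : Multiset (ZMod N)) = {u * r₁, u * s₁, u * t₁} := by
  obtain ⟨S₀, hS₀, hcard⟩ := exists_goodFinset_three_primes hp hq hr hp5 hq5 hr5 hpq hpr hqr ha hb hc hN
  obtain ⟨hN1, hN2⟩ := level_hyps₃ hp hq hr hp5 hq5 hr5 ha hN
  exact isIsogenous_fermatCMType_iff_exists_multiset_eq_of_card hN1 hN2 S₀ hS₀ hcard hr₁ hs₁ ht₁ h₁ hr₂ hs₂ ht₂ h₂ hS hS'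
    hA hA'

end ThreePrimeLevel

end CyclotomicFermatCMType

end Literature.AlgebraicGeometry.ComplexMultiplication
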